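import Summits.KontsevichZagierPeriods.Zeta5Search.SymmetricPhatDenominators
import Summits.KontsevichZagierPeriods.Zeta5Search.SymRayZudilinBridge
import Summits.KontsevichZagierPeriods.Zeta5Search.BrickDenominatorsTwo
import Summits.KontsevichZagierPeriods.Zeta5Search.Zudilin2002IntegralityTwoAdic
import HarnessLib

/-!
# The `ζ(5)`-companion modulo the leading coefficient: `2·D_n⁵·u_n·p_n ∈ ℤ` for every `n ≥ 1` (cell `pub-zeta5`, seat ct-1 g46)

HONEST FRAMING: systematic search; no irrationality claim unless certified.  Integrality bookkeeping of Zudilin's 2002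
numerators `p_n` (`ℓ_n = q_nζ(5) − p_n`, Mat. Zametki **72**, (2), (15)); nothing here concerns the arithmetic nature of
`ζ(5)`; no `γ` / record statement; records in print UNMOVED; net named-fact debt 0.  Theorems only.

WHAT IS OPEN: Zudilin's display (6) `2D_n⁵p_n ∈ ℤ` (Brown–Zudilin (6): `12d_n⁵P_n`, the `δ = 5` MODEL of the cell's
`Certificates/SymmetricRow`); proved in print and in the tree: `4D_n⁷p_n ∈ ℤ` (`Zudilin2002.integrality`, `integrality_holds`).
THIS FILE: the missing two powers of `D_n` ARE there up to the integer factor `u_n` (Zudilin's leading coefficient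
`u_n = 1, 9, 469, 38601, …` of `r_n = u_nζ(5) + w_nζ(3) − v_n`): **`2·D_n⁵·u_n·p_n ∈ ℤ`**, i.e. for every prime `ℓ ∤ u_n` the conjectured
inclusion holds `ℓ`-adically.  It is NOT the conjecture: `gcd`-type losses are real (`3 ∣ u_3 = 38601`), and nothing is claimed
beyond the displayed statement.

OUR work (Summit side): the Plücker-type identity of the three minors (15) with the row `(u,w,v)`,
`u_n·p_n + w_n·p̃_n = v_n·q_n` (`u_mul_p_add_w_mul_ptilde`, exact), and the tree's integrality of EACH factor:
`q_n ∈ ℤ` (`Zudilin2002IntegralityTwoAdic.q_isInt`), `D_n²w_n ∈ ℤ`, `2D_n⁵v_n ∈ ℤ` (`BrickDenominatorsTwo`, ct-1 g44: Krattenthaler–Rivoal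
strength at every prime), and the NEW `2D_n³p̃_n ∈ ℤ` (`SymmetricPhatDenominators`, this seat) — so
`2D⁵u·p = (2D⁵v)·q − (D²w)·(2D³p̃) ∈ ℤ` (`two_mul_lcmUpto_pow_five_mul_uC_mul_p_isInt`).
-/

noncomputable section

namespace Summit.KontsevichZagierPeriods.Zeta5Search.SymmetricPModuloU

open Literature.NumberTheory.Irrationality
open Literature.NumberTheory.Irrationality.Zudilin2002 (q p ptilde uC wC vC utC wtC vtC minorQ minorP minorPt)
open Summit.KontsevichZagierPeriods.Zeta5Search.SymmetricPhatDenominators (two_mul_lcmUpto_pow_three_mul_ptilde_isInt)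

/-- The Plücker-type identity of the minors (15) with the row `(u, w, v)`: `u·(w̃v − wṽ) + w·(uṽ − ũv) = v·(uw̃ − ũw)`. -/
theorem uC_mul_minorP_add (n : ℕ) : uC n * minorP n + wC n * minorPt n = vC n * minorQ n := by
  unfold minorP minorPt minorQ; ring

/-- **`u_n·p_n + w_n·p̃_n = v_n·q_n`** for Zudilin's recursion solutions (through (15), `SymRay.eq15`). -/
theorem u_mul_p_add_w_mul_ptilde (n : ℕ) : uC n * p n + wC n * ptilde n = vC n * q n := by
  obtain ⟨hq, hp, hpt⟩ := SymRay.eq15 n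
  rw [hq, hp, hpt]
  exact uC_mul_minorP_add n

/-- **`2·D_n⁵·u_n·p_n ∈ ℤ` for every `n ≥ 1`**: the `ζ(5)`-companion has the conjectured denominator `2D_n⁵` at every prime
not dividing the leading coefficient `u_n`. -/
theorem two_mul_lcmUpto_pow_five_mul_uC_mul_p_isInt (n : ℕ) (hn : 1 ≤ n) :
    ∃ z : ℤ, (z : ℚ) = 2 * (Nat.lcmUpto n : ℚ) ^ 5 * uC n * p n := by
  obtain ⟨zq, hzq⟩ := Zudilin2002IntegralityTwoAdic.q_isInt n
  obtain ⟨zw, hzw⟩ := BrickDenominatorsTwo.lcmUpto_sq_mul_wC_isInt n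
  obtain ⟨zv, hzv⟩ := BrickDenominatorsTwo.two_mul_lcmUpto_pow_five_mul_vC_isInt n
  obtain ⟨zt, hzt⟩ := two_mul_lcmUpto_pow_three_mul_ptilde_isInt n hn
  refine ⟨zv * zq - zw * zt, ?_⟩
  have h := u_mul_p_add_w_mul_ptilde n
  push_cast
  rw [← hzq, ← hzw, ← hzv, hzt]
  linear_combination (-2) * (Nat.lcmUpto n : ℚ) ^ 5 * h

/-- The same with `u_n` exhibited as an integer: `∃ u z : ℤ, u = u_n ∧ z = 2D_n⁵·u·p_n`. -/
theorem exists_int_uC_and_isInt (n : ℕ) (hn : 1 ≤ n) :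
    ∃ u z : ℤ, (u : ℚ) = uC n ∧ (z : ℚ) = 2 * (Nat.lcmUpto n : ℚ) ^ 5 * u * p n := by
  obtain ⟨u, hu⟩ := BrickDenominatorsTwo.uC_isInt n
  obtain ⟨z, hz⟩ := two_mul_lcmUpto_pow_five_mul_uC_mul_p_isInt n hn
  exact ⟨u, z, hu.symm, by rw [hz, hu]⟩

end Summit.KontsevichZagierPeriods.Zeta5Search.SymmetricPModuloU
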